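import Summits.ResolutionOfSingularities.ResolutionOfSingularities.Theorems.HomologicalConductorNoZenoStagePresentation
import Summits.ResolutionOfSingularities.ResolutionOfSingularities.Theorems.HomologicalConductorNoZenoDiscreteDominator
import Summits.ResolutionOfSingularities.ResolutionOfSingularities.Theorems.HomologicalConductorNoZenoCompositeDominator
import Summits.ResolutionOfSingularities.ResolutionOfSingularities.Theorems.HomologicalConductorNoZenoMaxDominator
import Summits.ResolutionOfSingularities.ResolutionOfSingularities.Theorems.HomologicalConductorNoZenoNoetherianCapture
import HarnessLib

/-!
# Crux `NoZenoR` (stmt-ResolutionOfSingularities-19943): the kernel datum in NORMAL FORM —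
# re-basing invariance of the kernel binders, a finitely generated NORMAL model at every stage, and
# `NoZenoR` ⟺ «under `StrictDrop`, no NORMAL, MAXIMALLY DOMINATED kernel datum» (fact-free)

Route `ResolutionOfSingularities/HomologicalConductor` (cell decomp-res, hand leafhand-res-homologicalconduct-14 g0).
OURS: AI-written bookkeeping over tree theorems, weaker than expert review; nothing here is a statement of the
manuscript under review (Hironaka 2017).  SUPPORT level, counted 0.  Def-free, fact-free, no new named facts.

The tree's fact-free door `NoZeno.DiscreteDominator.noZenoR_iff_noKernelDatum` reads the crux as: under `StrictDrop`,
NO admissible datum `(p, k, K, O, A)` has a canonical normalised `ca`-tower all of whose weak dominators are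
non-noetherian.  This file records that the kernel binders are invariant under RE-BASING the tower at any stage
(the tree's `exists_fg_model_tower_eq` / `StagePresentation.exists_fg_normal_presentation` supply the models) and
derives the normal form a future attack may assume at no cost:

* `tower_model_eq_tower_add` — if `T_m = loc O B` then the `B`-tower is the shifted `A`-tower, `tower O B j = T_(m+j)`;
* `dominates_iff_of_rebase`, `kernel_iff_of_rebase`, `maxDominator_iff_of_rebase`, `terminates_iff_of_rebase` — weak
  domination, the kernel binder `hker`, the maximality binder `hmax` and termination are the SAME for `(O, A)` and for
  any re-based model `(O, B)`;
* `exists_normal_model_tower_succ` — every stage `T_(m+1)` is stage `0` of a finitely generated, INTEGRALLY CLOSED model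
  `A ≤ B ⊆ O` with `Frac B = K` (E. Noether + normality of the stages, tree `exists_fg_normal_presentation`);
* `noZenoR_iff_noNormalKernelDatum`, **`noZenoR_iff_noNormalMaxKernelDatum`** — `NoZenoR` ⟺ «given `StrictDrop`, there
  is NO admissible datum with `A` integrally closed (in itself and in `K`), every weak dominator of its tower
  non-noetherian, and `O` MAXIMAL among the weak dominators» (Zorn, tree `stub_maxDominator`, then the normal model of
  the `Om`-datum at stage `1`; dominance invariance `CompositeDominator.tower_eq_of_dominates`).

So in the kernel one may assume from the outset: `A` normal (hence `T_0 = A_𝔭` and every stage a normal local domain),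
every stage singular (`DiscreteDominator.not_isRegularLocalRing_of_kernel`), and `O` a maximal weak dominator.  No crux,
kill test or summit statement is proved; resolution in char p is NOT proved.
-/

noncomputable section

-- single-problem summit: the doubled namespace component `ResolutionOfSingularities` is forced
set_option linter.dupNamespace false

namespace Summit.ResolutionOfSingularities.ResolutionOfSingularities.Theorems.NoZenoR.KernelNormalForm

open Summit.ResolutionOfSingularities.ResolutionOfSingularities.Theses.HomologicalConductor
open Summit.ResolutionOfSingularities.ResolutionOfSingularities.Theorems
open Summit.ResolutionOfSingularities.ResolutionOfSingularities.Theorems.NoZeno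
open Summit.ResolutionOfSingularities.ResolutionOfSingularities.Theorems.NoZeno.Birth
open Literature.AlgebraicGeometry.Resolution

variable {k K : Type} [Field k] [Field K] [Algebra k K]

/-! ## §1 Re-basing the tower at a stage: the kernel binders do not change -/

/-- **Re-basing.** If the stage `T_m` is the centre-localisation `loc O B` of a subalgebra `B`, then the canonical tower of
`B` is the shifted tower of `A`: `tower O B j = T_(m+j)` (both towers iterate the same step `loc ∘ nrm ∘ chart`). [folklore] -/
theorem tower_model_eq_tower_add (O : ValuationSubring K) (A B : Subalgebra k K) (m : ℕ)
    (hB : tower O A m = loc O B) (j : ℕ) : tower O B j = tower O A (m + j) := by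
  induction j with
  | zero => rw [tower_zero, ← hB, Nat.add_zero]
  | succ j ih => rw [tower_succ, ih, ← tower_succ, Nat.add_assoc]

/-- **Weak domination is re-basing invariant**: a valuation ring `U` weakly dominates the shifted tower
(`T_(m+j) ⊆ U` with `U`-units `O`-units) iff it weakly dominates the whole tower — the stages increase, so the early
stages are controlled by `T_m`. [folklore] -/
theorem dominates_iff_of_rebase (O : ValuationSubring K) (A B : Subalgebra k K) (m : ℕ)
    (hB : ∀ j : ℕ, tower O B j = tower O A (m + j)) (U : ValuationSubring K) :
    (∀ j : ℕ, ∀ s ∈ tower O B j, s ∈ U ∧ (s⁻¹ ∈ U → s⁻¹ ∈ O)) ↔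
      ∀ i : ℕ, ∀ s ∈ tower O A i, s ∈ U ∧ (s⁻¹ ∈ U → s⁻¹ ∈ O) := by
  constructor
  · intro h i s hs
    have hs' : s ∈ tower O A (m + i) := d2rc_mem_tower_of_le O A (Nat.le_add_left i m) hs
    rw [← hB i] at hs'
    exact h i s hs'
  · intro h j s hs
    rw [hB j] at hs
    exact h (m + j) s hs

/-- **The kernel binder `hker` is re-basing invariant**: every weak dominator of the `B`-tower is non-noetherian iff
every weak dominator of the `A`-tower is. [folklore] -/
theorem kernel_iff_of_rebase (O : ValuationSubring K) (A B : Subalgebra k K) (m : ℕ)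
    (hB : ∀ j : ℕ, tower O B j = tower O A (m + j)) :
    (∀ U : ValuationSubring K,
        (∀ j : ℕ, ∀ s ∈ tower O B j, s ∈ U ∧ (s⁻¹ ∈ U → s⁻¹ ∈ O)) → ¬ IsNoetherianRing ↥U) ↔
      ∀ U : ValuationSubring K,
        (∀ i : ℕ, ∀ s ∈ tower O A i, s ∈ U ∧ (s⁻¹ ∈ U → s⁻¹ ∈ O)) → ¬ IsNoetherianRing ↥U :=
  ⟨fun h U hU => h U ((dominates_iff_of_rebase O A B m hB U).mpr hU),
    fun h U hU => h U ((dominates_iff_of_rebase O A B m hB U).mp hU)⟩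

/-- **The maximality binder `hmax` is re-basing invariant**: every `O' > O` inverts a stage element of the `B`-tower
outside `O` iff it does so for the `A`-tower. [folklore] -/
theorem maxDominator_iff_of_rebase (O : ValuationSubring K) (A B : Subalgebra k K) (m : ℕ)
    (hB : ∀ j : ℕ, tower O B j = tower O A (m + j)) :
    (∀ O' : ValuationSubring K, O < O' → ∃ j : ℕ, ∃ s ∈ tower O B j, s⁻¹ ∈ O' ∧ s⁻¹ ∉ O) ↔
      ∀ O' : ValuationSubring K, O < O' → ∃ i : ℕ, ∃ s ∈ tower O A i, s⁻¹ ∈ O' ∧ s⁻¹ ∉ O := by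
  constructor
  · intro h O' hlt
    obtain ⟨j, s, hs, h₁, h₂⟩ := h O' hlt
    rw [hB j] at hs
    exact ⟨m + j, s, hs, h₁, h₂⟩
  · intro h O' hlt
    obtain ⟨i, s, hs, h₁, h₂⟩ := h O' hlt
    have hs' : s ∈ tower O A (m + i) := d2rc_mem_tower_of_le O A (Nat.le_add_left i m) hs
    rw [← hB i] at hs'
    exact ⟨i, s, hs', h₁, h₂⟩

/-- **Termination is re-basing invariant**: some stage of the `B`-tower is regular iff some stage of the `A`-tower is
(backwards: the tower is stationary after a regular stage, tree `NoetherianCapture.tower_eq_of_le_of_isRegularLocalRing`).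
[folklore] -/
theorem terminates_iff_of_rebase (O : ValuationSubring K) (A B : Subalgebra k K)
    (hk : ∀ c : k, algebraMap k K c ∈ O) (hfr : IsFractionRing ↥A K) (hAO : A.toSubring ≤ O.toSubring)
    (m : ℕ) (hB : ∀ j : ℕ, tower O B j = tower O A (m + j)) :
    (∃ j : ℕ, IsRegularLocalRing ↥(tower O B j)) ↔ ∃ i : ℕ, IsRegularLocalRing ↥(tower O A i) := by
  constructor
  · rintro ⟨j, hj⟩
    exact ⟨m + j, by rw [← hB j]; exact hj⟩
  · rintro ⟨i, hi⟩
    refine ⟨i, ?_⟩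
    rw [hB i, NoetherianCapture.tower_eq_of_le_of_isRegularLocalRing O A hk hfr hAO i hi (m + i)
      (Nat.le_add_left i m)]
    exact hi

/-! ## §2 A finitely generated NORMAL model at every stage -/

/-- **Every stage `T_(m+1)` is stage `0` of a finitely generated NORMAL model.**  For an admissible datum (`k, A ⊆ O`,
`A` finitely generated, `Frac A = K`) and every `m` there is a finitely generated `k`-subalgebra `A ≤ B ≤ T_(m+1)`,
`B ⊆ O`, with `Frac B = K`, integrally closed (as a ring, and in `K`), whose canonical tower is the shifted tower:
`tower O B j = T_(m+1+j)` for all `j`.  (Tree: `StagePresentation.exists_fg_normal_presentation`,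
`StagePresentation.tower_eq_loc_of_fractions`; E. Noether's finiteness of integral closure and normality of the stages.)
[cite: Liu2002, Prop. 4.1.27, p. 122] -/
theorem exists_normal_model_tower_succ (O : ValuationSubring K) (A : Subalgebra k K)
    (hk : ∀ c : k, algebraMap k K c ∈ O) (hA : A.FG) (hfr : IsFractionRing ↥A K)
    (hAO : A.toSubring ≤ O.toSubring) (m : ℕ) :
    ∃ B : Subalgebra k K, B.FG ∧ A ≤ B ∧ B.toSubring ≤ O.toSubring ∧ IsFractionRing ↥B K ∧
      IsIntegrallyClosed ↥B ∧ (∀ x : K, IsIntegral ↥B x → x ∈ B) ∧ B ≤ tower O A (m + 1) ∧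
      ∀ j : ℕ, tower O B j = tower O A (m + 1 + j) := by
  obtain ⟨B, hBfg, hAB, hBT, hBic, hBint, hfrac⟩ :=
    StagePresentation.exists_fg_normal_presentation O A hk hA hfr hAO m
  have hT : tower O A (m + 1) = loc O B :=
    StagePresentation.tower_eq_loc_of_fractions O A hk hAO (m + 1) B hBT hfrac
  have hBO : B.toSubring ≤ O.toSubring := fun x hx =>
    mem_valuationSubring_of_mem_tower O hk hAO (m + 1) x (hBT hx)
  haveI := hfr
  exact ⟨B, hBfg, hAB, hBO, isFractionRing_subalgebra_of_le A B hAB, hBic, hBint, hBT,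
    tower_model_eq_tower_add O A B (m + 1) hT⟩

/-- **A kernel datum re-bases to a NORMAL kernel datum** with the same valuation ring: if every weak dominator of the
`(O, A)`-tower is non-noetherian, the same holds for the finitely generated normal model `B` of `T_1`, and the maximality
binder is carried along. [this work; composition of tree results] -/
theorem exists_normal_kernelDatum_of_kernelDatum (O : ValuationSubring K) (A : Subalgebra k K)
    (hk : ∀ c : k, algebraMap k K c ∈ O) (hA : A.FG) (hfr : IsFractionRing ↥A K)
    (hAO : A.toSubring ≤ O.toSubring)
    (hker : ∀ U : ValuationSubring K,
      (∀ i : ℕ, ∀ s ∈ tower O A i, s ∈ U ∧ (s⁻¹ ∈ U → s⁻¹ ∈ O)) → ¬ IsNoetherianRing ↥U) :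
    ∃ B : Subalgebra k K, B.FG ∧ A ≤ B ∧ B.toSubring ≤ O.toSubring ∧ IsFractionRing ↥B K ∧
      IsIntegrallyClosed ↥B ∧ (∀ x : K, IsIntegral ↥B x → x ∈ B) ∧
      (∀ j : ℕ, tower O B j = tower O A (1 + j)) ∧
      (∀ U : ValuationSubring K,
        (∀ j : ℕ, ∀ s ∈ tower O B j, s ∈ U ∧ (s⁻¹ ∈ U → s⁻¹ ∈ O)) → ¬ IsNoetherianRing ↥U) ∧
      ((∀ O' : ValuationSubring K, O < O' → ∃ i : ℕ, ∃ s ∈ tower O A i, s⁻¹ ∈ O' ∧ s⁻¹ ∉ O) →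
        ∀ O' : ValuationSubring K, O < O' → ∃ j : ℕ, ∃ s ∈ tower O B j, s⁻¹ ∈ O' ∧ s⁻¹ ∉ O) := by
  obtain ⟨B, hBfg, hAB, hBO, hBfr, hBic, hBint, -, hBtower⟩ :=
    exists_normal_model_tower_succ O A hk hA hfr hAO 0
  refine ⟨B, hBfg, hAB, hBO, hBfr, hBic, hBint, hBtower, (kernel_iff_of_rebase O A B _ hBtower).mpr hker,
    fun hmax => (maxDominator_iff_of_rebase O A B _ hBtower).mpr hmax⟩

/-! ## §3 The crux in kernel NORMAL FORM -/

/-- **`NoZenoR` ⟺ «given `StrictDrop`, no NORMAL kernel datum»** (fact-free): the tree's `noZenoR_iff_noKernelDatum` with the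
extra binders «`A` integrally closed, and integrally closed in `K`» on the excluded datum.  `→` specialises; `←` re-bases an
arbitrary kernel datum at the normal model of its first normalised stage (`exists_normal_kernelDatum_of_kernelDatum`).
[this work; composition of tree results] -/
theorem noZenoR_iff_noNormalKernelDatum : NoZenoR ↔ (StrictDrop → ∀ p : ℕ, p.Prime →
    ∀ (k K : Type) [Field k] [CharP k p] [Field K] [Algebra k K] (O : ValuationSubring K)
      (A : Subalgebra k K), (∀ c : k, algebraMap k K c ∈ O) → A.FG → IsFractionRing ↥A K →
      A.toSubring ≤ O.toSubring → IsIntegrallyClosed ↥A → (∀ x : K, IsIntegral ↥A x → x ∈ A) →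
      ¬ (∀ O' : ValuationSubring K,
        (∀ m : ℕ, ∀ s ∈ tower O A m, s ∈ O' ∧ (s⁻¹ ∈ O' → s⁻¹ ∈ O)) → ¬ IsNoetherianRing ↥O')) := by
  rw [DiscreteDominator.noZenoR_iff_noKernelDatum]
  constructor
  · intro h hD p hp k K _ _ _ _ O A hk hA hfr hAO _ _
    exact h hD p hp k K O A hk hA hfr hAO
  · intro h hD p hp k K _ _ _ _ O A hk hA hfr hAO hker
    obtain ⟨B, hBfg, -, hBO, hBfr, hBic, hBint, -, hkerB, -⟩ :=
      exists_normal_kernelDatum_of_kernelDatum O A hk hA hfr hAO hker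
    exact h hD p hp k K O B hk hBfg hBfr hBO hBic hBint hkerB

/-- **`NoZenoR` ⟺ «given `StrictDrop`, no NORMAL, MAXIMALLY DOMINATED kernel datum»** (fact-free): under `StrictDrop` there is
NO admissible datum `(p, k, K, O, A)` with `A` integrally closed (in itself and in `K`), every weak dominator of its canonical
tower non-noetherian, and `O` MAXIMAL among the weak dominators (every `O' > O` inverts some stage element outside `O`).
`→`: specialise `noZenoR_iff_noKernelDatum`.  `←`: given any kernel datum `(O, A)`, Zorn (`stub_maxDominator`) gives a maximal
weak dominator `Om ≥ O`; the `Om`-tower IS the `O`-tower (`CompositeDominator.tower_eq_of_dominates`) with the same weak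
dominators (`dominates_iff_of_dominates`), so `(Om, A)` is a maximal kernel datum; re-base it at the normal model of `T_1`
(`exists_normal_kernelDatum_of_kernelDatum`).  This is the common normal form of the v34 registry's kernel block
(`hker`, `hmax`) with normality of the affine model added, WITHOUT dimension / exhaustion / transcendence-degree binders.
[this work; composition of tree results] [cite: ZariskiSamuel1960, Ch. VI §5] -/
theorem noZenoR_iff_noNormalMaxKernelDatum : NoZenoR ↔ (StrictDrop → ∀ p : ℕ, p.Prime →
    ∀ (k K : Type) [Field k] [CharP k p] [Field K] [Algebra k K] (O : ValuationSubring K)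
      (A : Subalgebra k K), (∀ c : k, algebraMap k K c ∈ O) → A.FG → IsFractionRing ↥A K →
      A.toSubring ≤ O.toSubring → IsIntegrallyClosed ↥A → (∀ x : K, IsIntegral ↥A x → x ∈ A) →
      (∀ O' : ValuationSubring K,
        (∀ m : ℕ, ∀ s ∈ tower O A m, s ∈ O' ∧ (s⁻¹ ∈ O' → s⁻¹ ∈ O)) → ¬ IsNoetherianRing ↥O') →
      (∀ O' : ValuationSubring K, O < O' → ∃ m : ℕ, ∃ s ∈ tower O A m, s⁻¹ ∈ O' ∧ s⁻¹ ∉ O) →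
      False) := by
  rw [DiscreteDominator.noZenoR_iff_noKernelDatum]
  constructor
  · intro h hD p hp k K _ _ _ _ O A hk hA hfr hAO _ _ hker _
    exact h hD p hp k K O A hk hA hfr hAO hker
  · intro h hD p hp k K _ _ _ _ O A hk hA hfr hAO hker
    -- a maximal weak dominator `Om ≥ O` of the tower
    obtain ⟨Om, -, hdom, hmax⟩ := stub_maxDominator k K O A hk hAO
    have hT : ∀ m : ℕ, tower Om A m = tower O A m :=
      CompositeDominator.tower_eq_of_dominates O A Om hk hA hfr hAO hdom
    have hk' : ∀ c : k, algebraMap k K c ∈ Om := CompositeDominator.algebraMap_mem_of_dominates O A Om hdom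
    have hAO' : A.toSubring ≤ Om.toSubring := CompositeDominator.le_of_dominates O A Om hdom
    have hker' : ∀ U : ValuationSubring K,
        (∀ m : ℕ, ∀ s ∈ tower Om A m, s ∈ U ∧ (s⁻¹ ∈ U → s⁻¹ ∈ Om)) → ¬ IsNoetherianRing ↥U :=
      fun U hU => hker U ((CompositeDominator.dominates_iff_of_dominates O A Om hk hA hfr hAO hdom U).mp hU)
    have hmax' : ∀ O' : ValuationSubring K, Om < O' → ∃ m : ℕ, ∃ s ∈ tower Om A m, s⁻¹ ∈ O' ∧ s⁻¹ ∉ Om := by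
      intro O' hlt
      obtain ⟨m, s, hs, hinv, hninv⟩ := hmax O' hlt
      rw [← hT m] at hs
      exact ⟨m, s, hs, hinv, hninv⟩
    -- re-base the maximal kernel datum `(Om, A)` at the normal model of its first normalised stage
    obtain ⟨B, hBfg, -, hBO, hBfr, hBic, hBint, -, hkerB, hmaxB⟩ :=
      exists_normal_kernelDatum_of_kernelDatum Om A hk' hA hfr hAO' hker'
    exact h hD p hp k K Om B hk' hBfg hBfr hBO hBic hBint hkerB (hmaxB hmax')

/-- **In the normal form every stage is a singular stage** (fact-free restatement for users of the normal form): a kernel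
datum has NO regular stage (`DiscreteDominator.not_isRegularLocalRing_of_kernel`), before or after re-basing. [folklore] -/
theorem not_isRegularLocalRing_of_kernel_rebase (O : ValuationSubring K) (A B : Subalgebra k K)
    (hk : ∀ c : k, algebraMap k K c ∈ O) (hfr : IsFractionRing ↥A K) (hAO : A.toSubring ≤ O.toSubring)
    (m : ℕ) (hB : ∀ j : ℕ, tower O B j = tower O A (m + j))
    (hker : ∀ U : ValuationSubring K,
      (∀ i : ℕ, ∀ s ∈ tower O A i, s ∈ U ∧ (s⁻¹ ∈ U → s⁻¹ ∈ O)) → ¬ IsNoetherianRing ↥U)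
    (j : ℕ) : ¬ IsRegularLocalRing ↥(tower O B j) := by
  rw [hB j]
  exact DiscreteDominator.not_isRegularLocalRing_of_kernel O A hk hfr hAO hker (m + j)

end Summit.ResolutionOfSingularities.ResolutionOfSingularities.Theorems.NoZenoR.KernelNormalForm

end
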